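import Summits.CriticalPhenomena.PercolationContinuityZ3.Theorems.PercNearOneGluingNoHeavyLowerTailQ7Three
import Literature.Probability.Percolation.KozmaNitzanClusterSizeReduction
import HarnessLib

/-!
# `NoHeavyLowerTail` (stmt-CriticalPhenomena-4575) — Kozma–Nitzan's Conjecture 4 and Conjecture 2 for three relays,
# in the literal printed shapes

Support file (`--supports stmt-CriticalPhenomena-4575`), coupling seat `prim-cplus-coupling` (gen 9).  No definitions,
no named facts, no sorries.

Kozma–Nitzan (arXiv:2401.12397): Conjecture 4 (p. 32) — for every monotone cluster property `f` and every relay set `A`,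
`E(f(0)·𝟙{0↔A}) ≥ min_{a∈A} E(f(a)·𝟙{0↔A})` ("a far-reaching generalisation of conjecture 2"; proved in print only for
`|A| = 2` (Thm 7), for `0` isolated in `G ∖ A` (Thm 8), and for `f = 𝟙{|C| ≥ k}`, `k ≤ 4` (Thm 9)); Conjecture 2 (p. 3,
display (3)) is its case `f = 𝟙{· ↔ b}` (`KozmaNitzan2024_conjecture2_of_conjecture4_indicator`).
THIS FILE: both for `|A| = 3` on every finite weighted graph, from `Q7Psi.gpsi_three` ((GΨ₃), this seat, via COV(τ)):

* `Q7Psi.kn_conj4_three` — `|A| = 3`, `F` monotone: `∃ a ∈ A, ∫_{0↔A} F(C a) ≤ ∫_{0↔A} F(C 0)` (the minimiser of `E F(C a)`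
  works: on `{0↔a} ∖ {0↔A∖a}` the two clusters coincide, and on `{0 ↔ A∖a}` it is (GΨ₃));
* `Q7Psi.kn_conj2_three` — `|A| = 3`: `∃ a ∈ A, μ({a↔b} ∩ {0↔A}) ≤ μ({0↔b} ∩ {0↔A})` (display (3), any `b`, also `b ∈ A`).
[cite: KozmaNitzan2024, Conjecture 4 and Theorems 7–9 (p. 32), Conjecture 2 / display (3) (p. 3), Question 7 (p. 36)]
-/

namespace Summit.CriticalPhenomena.PercolationContinuityZ3.Theorems

open MeasureTheory Set Literature.Probability.LatticeModels Literature.Probability.Percolation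
open scoped Classical
open KNPreFKG

noncomputable section

namespace Q7Psi

universe u

variable {V : Type u} [Fintype V]

/-- **Kozma–Nitzan's Conjecture 4 for three relays (designated form).**  For `A` of size three, any observer `o`, any
monotone real cluster property `F`: a relay `a ∈ A` minimising `E F(C a)` satisfies
`∫_{o↔A} F(C a) ≤ ∫_{o↔A} F(C o)`; in particular `∃ a ∈ A` with that property (the printed Conjecture 4 at `|A| = 3`).
[cite: KozmaNitzan2024, Conjecture 4 (p. 32)] -/
theorem kn_conj4_three (w : Sym2 V → unitInterval) (A : Finset V) (o : V) (hA : A.card = 3)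
    (F : Set V → ℝ) (hF : ∀ S T : Set V, S ⊆ T → F S ≤ F T) :
    ∃ a ∈ A, ∫ ω in ⋃ a' ∈ A, openConn o a', F (openCluster ω a) ∂(prodBernoulli w) ≤
      ∫ ω in ⋃ a' ∈ A, openConn o a', F (openCluster ω o) ∂(prodBernoulli w) := by
  classical
  set μ := prodBernoulli w with hμ
  have hAne : A.Nonempty := Finset.card_pos.1 (by omega)
  obtain ⟨z, hzA, hmin⟩ := A.exists_min_image (fun a => ∫ ω, F (openCluster ω a) ∂μ) hAne
  refine ⟨z, hzA, ?_⟩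
  -- the two other relays
  have hcard2 : (A.erase z).card = 2 := by rw [Finset.card_erase_of_mem hzA, hA]
  obtain ⟨x, y, hxy, hxy'⟩ := Finset.card_eq_two.1 hcard2
  have hxA' : x ∈ A.erase z := by rw [hxy']; simp
  have hyA' : y ∈ A.erase z := by rw [hxy']; simp
  have hxz : x ≠ z := (Finset.mem_erase.1 hxA').1
  have hyz : y ≠ z := (Finset.mem_erase.1 hyA').1
  have hxA : x ∈ A := (Finset.mem_erase.1 hxA').2
  have hyA : y ∈ A := (Finset.mem_erase.1 hyA').2
  have hAeq : A = {x, y, z} := by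
    rw [← Finset.insert_erase hzA, hxy']
    ext a; simp [or_comm, or_left_comm]
  have hU : (⋃ a' ∈ A, (openConn o a' : Set (BondConfig V))) = (openConn o x ∪ openConn o y) ∪ openConn o z := by
    rw [hAeq]; ext ω; simp [or_assoc]
  have hmeas : ∀ S : Set (BondConfig V), MeasurableSet S := fun _ => MeasurableSet.of_discrete
  have hint : ∀ (g : BondConfig V → ℝ) (S : Set (BondConfig V)), IntegrableOn g S μ :=
    fun g S => (Integrable.of_finite).integrableOn
  -- split `o↔A` into `o ↔ {x,y}` and `o↔z ∖ o↔{x,y}`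
  set J : Set (BondConfig V) := openConn o x ∪ openConn o y with hJ
  have hsplit : ∀ g : BondConfig V → ℝ, ∫ ω in J ∪ openConn o z, g ω ∂μ =
      ∫ ω in J, g ω ∂μ + ∫ ω in openConn o z \ J, g ω ∂μ := by
    intro g
    have hJz : J ∪ openConn o z = J ∪ (openConn o z \ J) := by
      ext ω; simp only [mem_union, mem_sdiff]; tauto
    rw [hJz, setIntegral_union disjoint_sdiff_right (hmeas _) (hint _ _) (hint _ _)]
  have heq : ∫ ω in openConn o z \ J, F (openCluster ω z) ∂μ = ∫ ω in openConn o z \ J, F (openCluster ω o) ∂μ := by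
    refine setIntegral_congr_fun (hmeas _) fun ω hω => ?_
    rw [openCluster_eq_of_reachable (show (openGraph ω).Reachable o z from hω.1)]
  have hx : ∫ ω, F (openCluster ω z) ∂μ ≤ ∫ ω, F (openCluster ω x) ∂μ := hmin x hxA
  have hy : ∫ ω, F (openCluster ω z) ∂μ ≤ ∫ ω, F (openCluster ω y) ∂μ := hmin y hyA
  have key := gpsi_three w o x y z hxy hxz hyz F hF hx hy
  rw [hU, hsplit, hsplit, heq]
  linarith

/-- **Kozma–Nitzan's Conjecture 2 (pre-FKG, display (3)) for three relays.**  For `A` of size three and any `o, b`: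
`∃ a ∈ A, μ({a↔b} ∩ {o↔A}) ≤ μ({o↔b} ∩ {o↔A})` — Conjecture 4 at `F = 𝟙{b ∈ ·}` (`kn_conj4_three` through
`KozmaNitzan2024_conjecture2_of_conjecture4_indicator`; `b ∈ A` allowed).
[cite: KozmaNitzan2024, Conjecture 2 and display (3) (p. 3), p. 32 (Conjecture 2 from Conjecture 4)] -/
theorem kn_conj2_three (w : Sym2 V → unitInterval) (A : Finset V) (o b : V) (hA : A.card = 3) :
    ∃ a ∈ A, (prodBernoulli w).real (openConn a b ∩ ⋃ a' ∈ A, openConn o a') ≤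
      (prodBernoulli w).real (openConn o b ∩ ⋃ a' ∈ A, openConn o a') := by
  classical
  refine KozmaNitzan2024_conjecture2_of_conjecture4_indicator w A o b ?_
  have hF : ∀ S T : Set V, S ⊆ T → (fun S : Set V => if b ∈ S then (1 : ℝ) else 0) S ≤
      (fun S : Set V => if b ∈ S then (1 : ℝ) else 0) T := by
    intro S T hST
    by_cases hS : b ∈ S
    · simp [hS, hST hS]
    · by_cases hT : b ∈ T
      · simp [hS, hT]
      · simp [hS, hT]
  exact kn_conj4_three w A o hA (fun S => if b ∈ S then (1 : ℝ) else 0) hF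

end Q7Psi

end

end Summit.CriticalPhenomena.PercolationContinuityZ3.Theorems
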